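import Mathlib
import HarnessLib
import Literature.NumberTheory.LFunctions.ZetaScrew
import Literature.NumberTheory.LFunctions.ZetaScrewThm41Proofs

/-!
# Route `IntegerScrew` — the SECOND-ORDER term of the pivot law's leading part `L(M)` (RH-FREE)

PIVOT-LAW §2a/§10.2 row «L third term `(log m + 5/2 − c₀)/(2m)` — DERIVED» made THEOREM, one order
beyond `IntegerScrewIncrementSharp`, from the closed form of `Ψ'` on the prime-free wall
(`Literature.NumberTheory.LFunctions.hasDerivAt_zetaScrew_wall`).  With `Λ(u) = (−u log u − c₀u)/2`,
`c₀ = log 2π + γ₀ − 1`: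
* `abs_zetaScrew_sub_secondOrderModel_le` : `|Ψ(t) − Λ(t) − (7/8)t²| ≤ t³/2` for `0 < t ≤ ½`
  (from `|Ψ'(u) − Λ'(u) − (7/4)u| ≤ u²/2`: third-order `exp` bounds, `log(1−a) ∈ [−a−2a², −a]`,
  `d/dx arctan(e^{−x}) + ½ = (1 − e^{−x})²/(2(1 + e^{−2x})) ∈ [0, x²/2]`);
* `abs_incrementEnergy_sub_secondOrder_le` : for `M ≥ 3`,
  `|M·2Ψ(log(M/(M−1))) − (log M − c₀) − (log M + 5/2 − c₀)/(2M)| ≤ (2 log M + 16)/M²`.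
A statement about the explicit function `Ψ` on `(0, log 2)`; no prime, no zero enters; nothing here
bears on the truth of RH.  Reference for `Ψ`: M. Suzuki, J. Lond. Math. Soc. (2) 108 (2023), (1.1),
proof of Thm 4.1 [Suzuki2023].
-/

noncomputable section

-- D-0017: `Summit.<S>.<S>.…` is the designed namespace of a single-problem summit.
set_option linter.dupNamespace false

namespace Summit.RiemannHypothesis.RiemannHypothesis.Theorems.IntegerScrew

open Literature.NumberTheory.LFunctions Literature.NumberTheory.LFunctions.Suzuki2023Thm41 Finset

/-! ### Elementary third-order inequalities -/

/-- `|e^x − 1 − x − x²/2| ≤ (2/9)|x|³` for `|x| ≤ 1` (`Real.exp_bound` with `n = 3`). [folklore] -/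
private theorem abs_exp_sub_quad_le {x : ℝ} (hx : |x| ≤ 1) :
    |Real.exp x - 1 - x - x ^ 2 / 2| ≤ 2 / 9 * |x| ^ 3 := by
  have h := Real.exp_bound hx (n := 3) (by norm_num)
  have hs : ∑ m ∈ range 3, x ^ m / (m.factorial : ℝ) = 1 + x + x ^ 2 / 2 := by
    simp [Finset.sum_range_succ, Nat.factorial]
  rw [hs] at h
  have h' : |Real.exp x - (1 + x + x ^ 2 / 2)| ≤ |x| ^ 3 * (2 / 9) := by
    have := h; simp only [Nat.succ_eq_add_one, Nat.factorial, Nat.cast_ofNat] at this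
    convert this using 2; norm_num
  calc |Real.exp x - 1 - x - x ^ 2 / 2| = |Real.exp x - (1 + x + x ^ 2 / 2)| := by ring_nf
    _ ≤ |x| ^ 3 * (2 / 9) := h'
    _ = 2 / 9 * |x| ^ 3 := by ring

/-- `|4 sinh x − 4x| ≤ (8/9)x³` for `0 < x ≤ 1`. [folklore] -/
private theorem abs_sinh_sub_le {x : ℝ} (hx0 : 0 < x) (hx1 : x ≤ 1) :
    |4 * Real.sinh x - 4 * x| ≤ 8 / 9 * x ^ 3 := by
  have e1 := abs_exp_sub_quad_le (x := x) (by rw [abs_of_pos hx0]; exact hx1)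
  have e2 := abs_exp_sub_quad_le (x := -x) (by rw [abs_neg, abs_of_pos hx0]; exact hx1)
  rw [abs_of_pos hx0] at e1; rw [abs_neg, abs_of_pos hx0] at e2
  rw [Real.sinh_eq, abs_le]; rw [abs_le] at e1 e2
  constructor <;> nlinarith [e1.1, e1.2, e2.1, e2.2]

/-- For `a ≤ ½`: `−a − 2a² ≤ log(1 − a) ≤ −a`. [folklore] -/
private theorem log_one_sub_bounds {a : ℝ} (ha : a ≤ 1 / 2) :
    -a - 2 * a ^ 2 ≤ Real.log (1 - a) ∧ Real.log (1 - a) ≤ -a := by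
  have h1a : 0 < 1 - a := by linarith
  constructor
  · have h := Real.one_sub_inv_le_log_of_pos h1a
    have hinv : (1 - a)⁻¹ ≤ 1 + a + 2 * a ^ 2 := by
      rw [inv_eq_one_div, div_le_iff₀ h1a]
      nlinarith [mul_nonneg (sq_nonneg a) (by linarith : (0:ℝ) ≤ 1 - 2 * a)]
    linarith
  · linarith [Real.log_le_sub_one_of_pos h1a]

/-- `y = e^{−x}` for `0 < x ≤ ¼`: `1 − x ≤ y`, `|y − (1 − x + x²/2)| ≤ (2/9)x³`, `y < 1`. [folklore] -/
private theorem exp_neg_bounds {x : ℝ} (hx0 : 0 < x) (hx1 : x ≤ 1 / 4) :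
    1 - x ≤ Real.exp (-x) ∧ |Real.exp (-x) - (1 - x + x ^ 2 / 2)| ≤ 2 / 9 * x ^ 3 ∧
      Real.exp (-x) < 1 := by
  refine ⟨by have := Real.add_one_le_exp (-x); linarith, ?_, by rw [Real.exp_lt_one_iff]; linarith⟩
  have e2 := abs_exp_sub_quad_le (x := -x) (by rw [abs_neg, abs_of_pos hx0]; linarith)
  rw [abs_neg, abs_of_pos hx0] at e2
  calc |Real.exp (-x) - (1 - x + x ^ 2 / 2)| = |Real.exp (-x) - 1 - -x - (-x) ^ 2 / 2| := by ring_nf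
    _ ≤ 2 / 9 * x ^ 3 := e2

/-- (p2a) `|log((1 + e^{−x})/2) + x/2| ≤ x²` for `0 < x ≤ ¼`. [folklore] -/
private theorem abs_log_one_add_exp_neg_le {x : ℝ} (hx0 : 0 < x) (hx1 : x ≤ 1 / 4) :
    |Real.log ((1 + Real.exp (-x)) / 2) + x / 2| ≤ x ^ 2 := by
  obtain ⟨hylo, hy, hy1⟩ := exp_neg_bounds hx0 hx1
  set y := Real.exp (-x) with hydef
  rw [abs_le] at hy
  set a : ℝ := (1 - y) / 2 with ha
  have ha0 : 0 ≤ a := by rw [ha]; linarith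
  have ha1 : a ≤ 1 / 2 := by rw [ha]; linarith
  have hr : (1 + y) / 2 = 1 - a := by rw [ha]; ring
  rw [hr]; obtain ⟨hl, hu⟩ := log_one_sub_bounds ha1
  have ha2 : |a - (x / 2 - x ^ 2 / 4)| ≤ x ^ 3 / 9 := by
    rw [ha, abs_le]; constructor <;> nlinarith [hy.1, hy.2]
  rw [abs_le] at ha2 ⊢
  have hax : a ≤ x := by nlinarith [ha2.2]
  constructor <;> nlinarith [ha2.1, ha2.2, hl, hu, sq_nonneg a, mul_pos hx0 hx0, ha0, hax]

/-- (p2b) `|log((1 − e^{−x})/x) + x/2| ≤ x²` for `0 < x ≤ ¼`. [folklore] -/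
private theorem abs_log_one_sub_exp_neg_div_le {x : ℝ} (hx0 : 0 < x) (hx1 : x ≤ 1 / 4) :
    |Real.log ((1 - Real.exp (-x)) / x) + x / 2| ≤ x ^ 2 := by
  obtain ⟨hylo, hy, hy1⟩ := exp_neg_bounds hx0 hx1
  set y := Real.exp (-x) with hydef
  rw [abs_le] at hy
  set a : ℝ := 1 - (1 - y) / x with ha
  have hq : (1 - y) / x = 1 - a := by rw [ha]; ring
  have ha2 : |a - x / 2| ≤ 2 / 9 * x ^ 2 := by
    have hxa : x * a = x - (1 - y) := by rw [ha]; field_simp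
    rw [abs_le]; constructor <;> nlinarith [hy.1, hy.2, hxa]
  rw [abs_le] at ha2
  have ha0 : 0 ≤ a := by nlinarith [ha2.1]
  have hax : a ≤ x := by nlinarith [ha2.2]
  rw [hq, abs_le]; obtain ⟨hl, hu⟩ := log_one_sub_bounds (show a ≤ 1 / 2 by linarith)
  constructor <;> nlinarith [ha2.1, ha2.2, hl, hu, sq_nonneg a, mul_pos hx0 hx0, ha0, hax]

/-- (p3) `|arctan(e^{−x}) − π/4 + x/2| ≤ x³/2` for `0 < x`: the derivative of
`z ↦ arctan(e^{−z}) + z/2` is `(1 − e^{−z})²/(2(1 + e^{−2z})) ∈ [0, z²/2]`. [folklore] -/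
private theorem abs_arctan_exp_neg_le {x : ℝ} (hx0 : 0 < x) :
    |Real.arctan (Real.exp (-x)) - Real.pi / 4 + x / 2| ≤ x ^ 3 / 2 := by
  set g : ℝ → ℝ := fun z => Real.arctan (Real.exp (-z)) + z / 2 with hg
  have hderiv : ∀ z : ℝ, HasDerivAt g
      (1 / (1 + Real.exp (-z) ^ 2) * (Real.exp (-z) * -1) + 1 / 2) z := by
    intro z
    have h1 : HasDerivAt (fun z : ℝ => Real.exp (-z)) (Real.exp (-z) * -1) z := by
      simpa using ((hasDerivAt_neg z).exp)
    have h3 : HasDerivAt (fun z : ℝ => z / 2) (1 / 2) z := by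
      simpa using (hasDerivAt_id z).div_const 2
    exact ((Real.hasDerivAt_arctan (Real.exp (-z))).comp z h1).add h3
  have hgb : ∀ z ∈ interior (Set.Icc 0 x), deriv g z ≤ x ^ 2 / 2 ∧ 0 ≤ deriv g z := by
    rw [interior_Icc]; intro z hz
    rw [(hderiv z).deriv]
    set y := Real.exp (-z) with hy
    have hylo : 1 - z ≤ y := by have := Real.add_one_le_exp (-z); rw [hy]; linarith
    have hy1 : y ≤ 1 := by rw [hy, Real.exp_le_one_iff]; linarith [hz.1]
    rw [show 1 / (1 + y ^ 2) * (y * -1) + 1 / 2 = (1 - y) ^ 2 / (2 * (1 + y ^ 2)) by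
      field_simp; ring]
    constructor
    · rw [div_le_div_iff₀ (by positivity) (by norm_num)]
      have h1 : (1 - y) ^ 2 ≤ z ^ 2 := by nlinarith
      have h2 : z ^ 2 ≤ x ^ 2 := by nlinarith [hz.1, hz.2]
      nlinarith [sq_nonneg y]
    · positivity
  have hcont : ContinuousOn g (Set.Icc 0 x) :=
    fun z _ => (hderiv z).continuousAt.continuousWithinAt
  have hdiff : DifferentiableOn ℝ g (interior (Set.Icc 0 x)) :=
    fun z _ => (hderiv z).differentiableAt.differentiableWithinAt
  have hup := (convex_Icc 0 x).image_sub_le_mul_sub_of_deriv_le hcont hdiff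
    (fun z hz => (hgb z hz).1) 0 (Set.left_mem_Icc.mpr hx0.le) x (Set.right_mem_Icc.mpr hx0.le) hx0.le
  have hlo := (convex_Icc 0 x).mul_sub_le_image_sub_of_le_deriv hcont hdiff
    (fun z hz => (hgb z hz).2) 0 (Set.left_mem_Icc.mpr hx0.le) x (Set.right_mem_Icc.mpr hx0.le) hx0.le
  simp only [hg, neg_zero, Real.exp_zero, Real.arctan_one, zero_div, add_zero, sub_zero, zero_mul]
    at hup hlo
  rw [abs_le]; constructor <;> nlinarith [hup, hlo, pow_pos hx0 3]

/-! ### The derivative gap at second order and the second-order model of `Ψ` at `0` -/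

/-- `Λ'(u) = −(log u)/2 − (γ₀ + log 2π)/2` for `Λ(u) = (−u log u − c₀u)/2`, `u > 0`, and the model
`Λ(u) + (7/8)u²` has derivative `Λ'(u) + (7/4)u`. [folklore] -/
private theorem hasDerivAt_secondOrderModel {u : ℝ} (hu : 0 < u) :
    HasDerivAt (fun u : ℝ => (-(u * Real.log u)
        - (Real.log (2 * Real.pi) + Real.eulerMascheroniConstant - 1) * u) / 2 + 7 / 8 * u ^ 2)
      (-(Real.log u) / 2 - (Real.eulerMascheroniConstant + Real.log (2 * Real.pi)) / 2 + 7 / 4 * u) u := by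
  have h1 : HasDerivAt (fun u : ℝ => u * Real.log u) (Real.log u + 1) u := by
    simpa using Real.hasDerivAt_mul_log hu.ne'
  have h2 : HasDerivAt (fun u : ℝ => (Real.log (2 * Real.pi) + Real.eulerMascheroniConstant - 1) * u)
      ((Real.log (2 * Real.pi) + Real.eulerMascheroniConstant - 1) * 1) u :=
    (hasDerivAt_id' u).const_mul _
  have h3 : HasDerivAt (fun u : ℝ => 7 / 8 * u ^ 2) (7 / 8 * (2 * u ^ 1 * 1)) u :=
    ((hasDerivAt_id' u).pow 2).const_mul _
  refine ((((h1.fun_neg).fun_sub h2).div_const 2).add h3).congr_deriv ?_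
  ring

/-- The derivative gap on the wall at second order: for `0 < u ≤ ½`,
`|Ψ₁-closed-form(u) − Λ'(u) − (7/4)u| ≤ u²/2`. [folklore] -/
private theorem abs_wallDeriv_sub_secondOrder_le {u : ℝ} (hu0 : 0 < u) (hu : u ≤ 1 / 2) :
    |(4 * Real.sinh (u / 2)
        - (Real.eulerMascheroniConstant + Real.pi / 2 + 3 * Real.log 2 + Real.log Real.pi) / 2
        + ((Real.log (1 + Real.exp (-(u / 2))) - Real.log (1 - Real.exp (-(u / 2)))) / 2
          + Real.arctan (Real.exp (-(u / 2)))))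
      - (-(Real.log u) / 2 - (Real.eulerMascheroniConstant + Real.log (2 * Real.pi)) / 2 + 7 / 4 * u)|
      ≤ u ^ 2 / 2 := by
  set x : ℝ := u / 2 with hx
  have hx0 : 0 < x := by positivity
  have hx1 : x ≤ 1 / 4 := by rw [hx]; linarith
  -- the four residuals (stated with `Real.exp (-x)`; then abbreviate `y := e^{−x}`)
  have hS := abs_sinh_sub_le hx0 (by linarith)
  have hB := abs_log_one_add_exp_neg_le hx0 hx1
  have hC := abs_log_one_sub_exp_neg_div_le hx0 hx1
  have hA := abs_arctan_exp_neg_le hx0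
  obtain ⟨hylo, _, hy1⟩ := exp_neg_bounds hx0 hx1
  set y : ℝ := Real.exp (-x) with hy
  -- rewrite the logs: log(1+y) = log 2 + log((1+y)/2), log(1−y) = log x + log((1−y)/x)
  have hlogB : Real.log (1 + y) = Real.log 2 + Real.log ((1 + y) / 2) := by
    rw [Real.log_div (by linarith) (by norm_num)]; ring
  have hlogC : Real.log (1 - y) = Real.log x + Real.log ((1 - y) / x) := by
    rw [Real.log_div (by linarith) hx0.ne']; ring
  have hlogu : Real.log u = Real.log x + Real.log 2 := by
    rw [hx, ← Real.log_mul hx0.ne' (by norm_num)]; congr 1; ring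
  have hlog2pi : Real.log (2 * Real.pi) = Real.log 2 + Real.log Real.pi :=
    Real.log_mul (by norm_num) Real.pi_pos.ne'
  have hux : u = 2 * x := by rw [hx]; ring
  rw [hlogB, hlogC, hlogu, hlog2pi, hux]
  rw [abs_le] at hS hB hC hA ⊢
  have hx3 : x ^ 3 ≤ x ^ 2 / 4 := by nlinarith [mul_pos hx0 hx0]
  constructor <;> nlinarith [hS.1, hS.2, hB.1, hB.2, hC.1, hC.2, hA.1, hA.2, hx3]

/-- **Second-order model of `Ψ` at `0`: `|Ψ(t) − Λ(t) − (7/8)t²| ≤ t³/2` for `0 < t ≤ ½`**, i.e.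
`2Ψ(t) = t log(1/t) − c₀t + (7/4)t² + θt³`, `|θ| ≤ 1`, `c₀ = log 2π + γ₀ − 1`. [folklore] -/
theorem abs_zetaScrew_sub_secondOrderModel_le {t : ℝ} (ht0 : 0 < t) (ht : t ≤ 1 / 2) :
    |zetaScrew t - ((-(t * Real.log t) - (Real.log (2 * Real.pi) + Real.eulerMascheroniConstant - 1) * t) / 2
      + 7 / 8 * t ^ 2)| ≤ t ^ 3 / 2 := by
  have htlog : t < Real.log 2 := by have := Real.log_two_gt_d9; linarith
  set D : ℝ → ℝ := fun u => zetaScrew u - ((-(u * Real.log u)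
      - (Real.log (2 * Real.pi) + Real.eulerMascheroniConstant - 1) * u) / 2 + 7 / 8 * u ^ 2) with hD
  have hD0 : D 0 = 0 := by simp [hD, zetaScrew_zero]
  have hcont : ContinuousOn D (Set.Icc 0 t) := by
    apply Continuous.continuousOn
    refine continuous_zetaScrew.sub ?_
    exact (((Real.continuous_mul_log.neg).sub (continuous_const.mul continuous_id)).div_const 2).add
      (continuous_const.mul (continuous_pow 2))
  have hderiv : ∀ u ∈ Set.Ioo 0 t, HasDerivAt D
      ((4 * Real.sinh (u / 2)
        - (Real.eulerMascheroniConstant + Real.pi / 2 + 3 * Real.log 2 + Real.log Real.pi) / 2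
        + ((Real.log (1 + Real.exp (-(u / 2))) - Real.log (1 - Real.exp (-(u / 2)))) / 2
          + Real.arctan (Real.exp (-(u / 2)))))
      - (-(Real.log u) / 2 - (Real.eulerMascheroniConstant + Real.log (2 * Real.pi)) / 2 + 7 / 4 * u)) u := by
    intro u hu
    exact (hasDerivAt_zetaScrew_wall hu.1 (lt_trans hu.2 htlog)).sub (hasDerivAt_secondOrderModel hu.1)
  have hdiff : DifferentiableOn ℝ D (interior (Set.Icc 0 t)) := by
    rw [interior_Icc]; exact fun u hu => (hderiv u hu).differentiableAt.differentiableWithinAt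
  have hbound : ∀ u ∈ interior (Set.Icc 0 t), |deriv D u| ≤ t ^ 2 / 2 := by
    rw [interior_Icc]; intro u hu
    rw [(hderiv u hu).deriv]
    refine le_trans (abs_wallDeriv_sub_secondOrder_le hu.1 (by linarith [hu.2])) ?_
    have : u ^ 2 ≤ t ^ 2 := by nlinarith [hu.1, hu.2]
    linarith
  have hup := (convex_Icc 0 t).image_sub_le_mul_sub_of_deriv_le hcont hdiff
    (fun u hu => (abs_le.mp (hbound u hu)).2) 0 (Set.left_mem_Icc.mpr ht0.le) t
    (Set.right_mem_Icc.mpr ht0.le) ht0.le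
  have hlo := (convex_Icc 0 t).mul_sub_le_image_sub_of_le_deriv hcont hdiff
    (fun u hu => (abs_le.mp (hbound u hu)).1) 0 (Set.left_mem_Icc.mpr ht0.le) t
    (Set.right_mem_Icc.mpr ht0.le) ht0.le
  rw [hD0, sub_zero] at hup hlo
  simp only [hD] at hup hlo
  rw [abs_le]; constructor <;> nlinarith [hup, hlo]

/-! ### The increment energy to second order -/

/-- `0 ≤ c₀ ≤ 2` for `c₀ = log 2π + γ₀ − 1` (`e < 2π < e²`, `½ < γ₀ < ⅔`). [folklore] -/
private theorem c0_bounds :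
    0 ≤ Real.log (2 * Real.pi) + Real.eulerMascheroniConstant - 1 ∧
      Real.log (2 * Real.pi) + Real.eulerMascheroniConstant - 1 ≤ 2 := by
  have hγ1 := Real.one_half_lt_eulerMascheroniConstant
  have hγ2 := Real.eulerMascheroniConstant_lt_two_thirds
  have h2pi : 0 < 2 * Real.pi := by positivity
  have hlo : 1 < Real.log (2 * Real.pi) := by
    rw [Real.lt_log_iff_exp_lt h2pi]
    have := Real.exp_one_lt_d9; have := Real.pi_gt_three; linarith
  have hhi : Real.log (2 * Real.pi) < 2 := by
    rw [Real.log_lt_iff_lt_exp h2pi]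
    have h1 := Real.exp_one_gt_d9
    have h2 : Real.exp 2 = Real.exp 1 * Real.exp 1 := by rw [← Real.exp_add]; norm_num
    have := Real.pi_lt_d2
    nlinarith [Real.exp_pos 1]
  constructor <;> linarith

set_option maxHeartbeats 400000 in
/-- **The increment energy to second order:
`|M·2Ψ(log(M/(M−1))) − (log M − c₀) − (log M + 5/2 − c₀)/(2M)| ≤ (2 log M + 16)/M²` for `M ≥ 3`**
(`c₀ = log 2π + γ₀ − 1`): the DERIVED third term of the pivot law's leading part `L(M)`
(PIVOT-LAW §2a) as a theorem. [folklore] -/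
theorem abs_incrementEnergy_sub_secondOrder_le (M : ℕ) (hM : 3 ≤ M) :
    |(M : ℝ) * (2 * zetaScrew (Real.log ((M : ℝ) / ((M : ℝ) - 1))))
        - (Real.log M - (Real.log (2 * Real.pi) + Real.eulerMascheroniConstant - 1))
        - (Real.log M + 5 / 2 - (Real.log (2 * Real.pi) + Real.eulerMascheroniConstant - 1))
            / (2 * (M : ℝ))|
      ≤ (2 * Real.log M + 16) / (M : ℝ) ^ 2 := by
  have hM3 : (3 : ℝ) ≤ M := by exact_mod_cast hM
  have hM0 : (0 : ℝ) < M := by linarith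
  have hMne : (M : ℝ) ≠ 0 := hM0.ne'
  have hM1ne : (M : ℝ) - 1 ≠ 0 := by linarith
  have hL1 : 1 ≤ Real.log M := by
    rw [Real.le_log_iff_exp_le hM0]
    have := Real.exp_one_lt_d9; linarith
  -- x = 1/M
  set x : ℝ := 1 / (M : ℝ) with hx
  have hx0 : 0 < x := by positivity
  have hx13 : x ≤ 1 / 3 := by
    rw [hx, div_le_div_iff₀ hM0 (by norm_num)]; linarith
  have hMx : (M : ℝ) * x = 1 := by rw [hx]; field_simp
  have hMx3 : (M : ℝ) * x ^ 3 = x ^ 2 := by linear_combination x ^ 2 * hMx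
  -- h = log(M/(M−1)) = −log(1 − x)
  set h : ℝ := Real.log ((M : ℝ) / ((M : ℝ) - 1)) with hh
  have hfrac : (M : ℝ) / ((M : ℝ) - 1) = (1 - x)⁻¹ := by
    rw [hx]; field_simp
  have hhx : h = -Real.log (1 - x) := by rw [hh, hfrac, Real.log_inv]
  -- series: h = x + x²/2 + ρ, |ρ| ≤ (3/2)x³
  have hser := Real.abs_log_sub_add_sum_range_le (x := x) (by rw [abs_of_pos hx0]; linarith) 2
  have hsum : ∑ i ∈ range 2, x ^ (i + 1) / ((i : ℝ) + 1) = x + x ^ 2 / 2 := by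
    simp [Finset.sum_range_succ]; norm_num
  rw [hsum, abs_of_pos hx0] at hser
  have hρ : |h - x - x ^ 2 / 2| ≤ 3 / 2 * x ^ 3 := by
    rw [show |h - x - x ^ 2 / 2| = |x + x ^ 2 / 2 + Real.log (1 - x)| by
      rw [hhx, ← abs_neg]; congr 1; ring]
    refine hser.trans ?_
    rw [div_le_iff₀ (by linarith)]; nlinarith [pow_pos hx0 3]
  rw [abs_le] at hρ
  have hh0 : 0 < h := by nlinarith [hρ.1, pow_pos hx0 2, pow_pos hx0 3]
  have hhalf : h ≤ 1 / 2 := by nlinarith [hρ.2, pow_pos hx0 2, pow_pos hx0 3]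
  -- s := M h − 1, h = x(1+s), |s − x/2| ≤ (3/2)x²
  set s : ℝ := (M : ℝ) * h - 1 with hs
  have hs_eq : h = x * (1 + s) := by
    rw [hs]; linear_combination (-h) * hMx
  have hs_bd : |s - x / 2| ≤ 3 / 2 * x ^ 2 := by
    have h1 : s - x / 2 = (M : ℝ) * (h - x - x ^ 2 / 2) := by
      rw [hs]; linear_combination (1 + x / 2) * hMx
    rw [h1, abs_mul, abs_of_pos hM0]
    calc (M : ℝ) * |h - x - x ^ 2 / 2| ≤ (M : ℝ) * (3 / 2 * x ^ 3) :=
          mul_le_mul_of_nonneg_left (abs_le.mpr hρ) hM0.le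
      _ = 3 / 2 * x ^ 2 := by linear_combination (3 / 2 : ℝ) * hMx3
  rw [abs_le] at hs_bd
  have hs0 : 0 ≤ s := by nlinarith [hs_bd.1]
  have hs1 : s ≤ x := by nlinarith [hs_bd.2]
  have hs13 : s ≤ 1 / 3 := hs1.trans hx13
  -- log h = log x + log(1+s) = −log M + s + τ, |τ| ≤ (3/2)s²
  have hlogx : Real.log x = -Real.log M := by rw [hx, one_div, Real.log_inv]
  have hτ' := Real.abs_log_sub_add_sum_range_le (x := -s) (by rw [abs_neg, abs_of_nonneg hs0]; linarith) 1
  have hsum1 : ∑ i ∈ range 1, (-s) ^ (i + 1) / ((i : ℝ) + 1) = -s := by simp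
  rw [hsum1, sub_neg_eq_add, abs_neg, abs_of_nonneg hs0] at hτ'
  set τ : ℝ := Real.log (1 + s) - s with hτdef
  have hτ : |τ| ≤ 3 / 2 * s ^ 2 := by
    rw [show |τ| = |-s + Real.log (1 + s)| by rw [hτdef]; congr 1; ring]
    refine hτ'.trans ?_
    rw [div_le_iff₀ (by linarith)]; nlinarith [sq_nonneg s]
  have hlogh : Real.log h = -Real.log M + (s + τ) := by
    rw [hs_eq, Real.log_mul hx0.ne' (by linarith), hlogx, hτdef]; ring
  -- the second-order model at h; abbreviate c₀ and the model error E
  have hΨ := abs_zetaScrew_sub_secondOrderModel_le hh0 hhalf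
  obtain ⟨hc0lo, hc0hi⟩ := c0_bounds
  set c₀ : ℝ := Real.log (2 * Real.pi) + Real.eulerMascheroniConstant - 1 with hc0
  set E : ℝ := zetaScrew h - ((-(h * Real.log h) - c₀ * h) / 2 + 7 / 8 * h ^ 2) with hE
  have hz : zetaScrew h = E + ((-(h * Real.log h) - c₀ * h) / 2 + 7 / 8 * h ^ 2) := by
    rw [hE]; ring
  have key : (M : ℝ) * (2 * zetaScrew h) - (Real.log M - c₀) - (Real.log M + 5 / 2 - c₀) / (2 * (M : ℝ))
      = (s - x / 2) * (Real.log M - 1 - c₀) - s ^ 2 - τ - s * τ + 7 / 4 * x * (2 * s + s ^ 2)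
        + (M : ℝ) * (2 * E) := by
    rw [hz, hlogh, hs_eq, hx]; field_simp; ring
  rw [key]
  have hA : |Real.log M - 1 - c₀| ≤ Real.log M + 3 := by
    rw [abs_le]; constructor <;> linarith
  have h1 : |(s - x / 2) * (Real.log M - 1 - c₀)| ≤ 3 / 2 * x ^ 2 * (Real.log M + 3) := by
    rw [abs_mul]
    exact mul_le_mul (abs_le.mpr hs_bd) hA (abs_nonneg _) (by positivity)
  have h2 : s ^ 2 ≤ x ^ 2 := pow_le_pow_left₀ hs0 hs1 2
  have h3 : |τ| ≤ 3 / 2 * x ^ 2 := hτ.trans (by linarith [h2])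
  have h4 : |s * τ| ≤ 1 / 2 * x ^ 2 := by
    rw [abs_mul, abs_of_nonneg hs0]
    calc s * |τ| ≤ (1 / 3) * (3 / 2 * x ^ 2) := mul_le_mul hs13 h3 (abs_nonneg _) (by norm_num)
      _ = 1 / 2 * x ^ 2 := by ring
  have h5 : 0 ≤ 7 / 4 * x * (2 * s + s ^ 2) ∧ 7 / 4 * x * (2 * s + s ^ 2) ≤ 49 / 12 * x ^ 2 := by
    constructor
    · positivity
    · have hxx : x ^ 2 ≤ x * (1 / 3) := by
        rw [sq]; exact mul_le_mul_of_nonneg_left hx13 hx0.le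
      have h2s : 2 * s + s ^ 2 ≤ 7 / 3 * x := by linarith [h2, hxx, hs1]
      calc 7 / 4 * x * (2 * s + s ^ 2) ≤ 7 / 4 * x * (7 / 3 * x) :=
            mul_le_mul_of_nonneg_left h2s (by positivity)
        _ = 49 / 12 * x ^ 2 := by ring
  have h6 : |(M : ℝ) * (2 * E)| ≤ 64 / 27 * x ^ 2 := by
    rw [abs_mul, abs_of_pos hM0]
    have hE3 : |2 * E| ≤ h ^ 3 := by
      rw [abs_mul, abs_two]; linarith [hΨ]
    have hh3 : h ^ 3 ≤ 64 / 27 * x ^ 3 := by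
      rw [hs_eq]
      have : (1 + s) ^ 3 ≤ 64 / 27 :=
        (pow_le_pow_left₀ (by linarith) (show 1 + s ≤ 4 / 3 by linarith) 3).trans (by norm_num)
      calc (x * (1 + s)) ^ 3 = x ^ 3 * (1 + s) ^ 3 := by ring
        _ ≤ x ^ 3 * (64 / 27) := by gcongr
        _ = 64 / 27 * x ^ 3 := by ring
    calc (M : ℝ) * |2 * E| ≤ (M : ℝ) * (64 / 27 * x ^ 3) :=
          mul_le_mul_of_nonneg_left (hE3.trans hh3) hM0.le
      _ = 64 / 27 * x ^ 2 := by linear_combination (64 / 27 : ℝ) * hMx3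
  have hrhs : (2 * Real.log M + 16) / (M : ℝ) ^ 2 = (2 * Real.log M + 16) * x ^ 2 := by
    rw [hx]; field_simp
  rw [hrhs]; rw [abs_le] at h1 h3 h4 h6 ⊢
  have hLx : 0 ≤ Real.log M * x ^ 2 := mul_nonneg (by linarith) (sq_nonneg x)
  constructor <;> linarith [h1.1, h1.2, h2, h3.1, h3.2, h4.1, h4.2, h5.1, h5.2, h6.1, h6.2, hLx,
    sq_nonneg s]

end Summit.RiemannHypothesis.RiemannHypothesis.Theorems.IntegerScrew
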